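/-
Copyright (c) 2026 the pub-hodgecm-mathlib formalisation cell (harness21).  Prover seat hodgecm-mathlib-K2E3-p03 (g9), Track B «K2-LIT» ∕ h413
(`stmt-HodgeConjecture-24833`), line `K2_E3_EllipticInputs`, unit U4 «Keys», cell «U4-RAM» (deal D171), PART «U4Keys» socket :155
`sig_K2E3KeysThmTwoContractingRamifiedCharOneDepthZeroNormTrivial` (depth 0, Branch B), plan step Z3-c (the Casselman pair), THE INTEGRANDS OF THE TWO NON-CONSTANT ENTRIES.
2026-09-04.
-/
import Summits.HodgeConjecture.HodgeConjecture.Theorems.K2E3BranchBCasselmanPairConstants   -- ★ Z3 p861713 (K2E3-p26 (g0)): the frame, ★ Z3-a FILES 1∕2 (`exists_coe_eA_eq_upper`, `mem_iff_v_le_one`, `exists_eq_mul_of_one_lt_v`, …, the four cell values)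
import Summits.HodgeConjecture.HodgeConjecture.Theorems.K2E3BranchBTypeLettersCM         -- ★ Z2-B CM p861663 (K2E3-p32 (g0)): `coe_weylConj_apply`; brings ★ `twist_comp_proj_apply_one`, ★ Z2A-3b `coe_eA_apply` ∕ `isUnit_of_apply_ne_zero`
import Summits.HodgeConjecture.HodgeConjecture.Theorems.F0P3cStCharTSBigCellFactorisation  -- ★ T4∕B4 FILE 1 (F0P3c): `neg_one_mem_normOneUnits`; brings ★ `F0P2oBorelTorusModulus.rootDeltaChar_cmBorel_eq_unitModulusChar_proj`, ★ `HeisRing.distribHaarChar_map_eq`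
import Literature.NumberTheory.Automorphic.CMPrincipalSeriesSpherical                     -- ★ `coe_torusEntry_proj_borelTriple` ∕ `val_proj_borelTriple` (`proj p = diag(p_ii)`)
import HarnessLib

/-!
# K2 ∕ E3 «EllipticInputs», unit U4 «Keys» — socket :155 (depth 0, Branch B), step Z3-c: THE INTEGRANDS OF THE TWO NON-CONSTANT ENTRIES OF THE CASSELMAN PAIR —
# `f(w₀ u) = χ₁(σz)⁻¹ · χ₂(−1) · ‖z‖⁻¹ · f(1)` for `|z|_w > 1` and `f(w₀ u w₀) = χ₁(σz)⁻¹ · χ₂(−1) · ‖z‖⁻¹ · f(w₀)` for `|z|_w ≥ 1`, `z = u₀₂`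

Cell hodgecm-mathlib (D-0151), FLOOR 0, Track B «K2-LIT», engine E3, crux item H413 = stmt-HodgeConjecture-24833 (route `HCCMUnconditional`, no route verbs); target BY NAME the
OPEN socket `…U4Keys.sig_K2E3KeysThmTwoContractingRamifiedCharOneDepthZeroNormTrivial` (:155; BRANCH B of design D-I v2 of K2E3-p06 (g4), `PAPER-Z3-DepthZeroInert` §0–§1), plan step
Z3-c «the integrands of `G₁ = Λ_1 f₁` and `G₂ = Λ_{w₀} f_w`».  Author K2E3-p03 (g9) (cell «U4-RAM», second hand of K2E3-p32 (g0); recipe (a)–(d) of K2E3-p26 (g0)'s HANDOFF 16:16:49Z).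
`--supports stmt-HodgeConjecture-24833 --as helper`; THEOREMS ONLY (no `def`, no `instance`, no notation, no named-fact hypothesis, no `sorry`).  NOT THE PAYER.

THE FRAME is ★ `K2E3BranchBCasselmanPairConstants`' (= ★ `K2E3BranchALettersCM`'s (G3) frame `(w hw eA heA ϖ hϖ g₁ hg₁ K0 K1 I hK0 hK1 hI)` + `w₀` of matrix `Φ₃`) with the parabolic
triple SPECIALISED to `cmBorelTriple L 3 v` and the inducing representation SPECIALISED to the principal-series character `τ = ((χ₁, χ₂) ∘ proj) ⊗ δ_B^{1∕2}` of ★ `cmPrincipalSeries L 3 v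
(cmTorusCharPair L v χ₁ χ₂)` (the socket has `χ₂ = 1`; `χ₂` is idle and kept).  For `u ∈ N(L⁺_v)` write `eA u = u(x, z)`, `z = (u₀₂)_w` (★ FILE 2 §0, ★ `coe_eA_apply`).
* §1 **`tau_apply_one_eq`** — THE `τ(p)`-READING: for the Borel factor `p` of ★ FILE 2 §2∕§3 (`eA p = [[(σz)⁻¹, −x∕z, 1],[0, −σz∕z, −σx],[0, 0, z]]`) and the unit `b ∈ (L ⊗ L⁺_v)ˣ` with
  `b_w = z`: `τ(p)·1 = χ₁((σb)⁻¹) · χ₂(−1) · ‖b‖⁻¹` — `δ_B^{1∕2}(p) = ‖(proj p)₀₀‖` (★ `rootDeltaChar_cmBorel_eq_unitModulusChar_proj`), `(proj p)₀₀ = p₀₀ = (σb)⁻¹` (★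
  `coe_torusEntry_proj_borelTriple`, one place over `v`: ★ `LocalRing.eq_iff_apply_eq`), `det(proj p) = p₀₀p₁₁p₂₂ = −1` (★ `val_proj_borelTriple`), `‖σb‖ = ‖b‖` (★ `HeisRing.distribHaarChar_map_eq`).
  This is the value of ★ B4 `F0P3cStCharTSBigCellFactorisation.toFun_weylElt_mul_eq_of_isUnit` (same three readings, intrinsic frame) transported to the (G3) frame's factor `p`.
* §2 for an `(I, θ)`-eigen-section `f` with `θ = 1` on the elements of `I` with `(0,0)`-entry `1` (depth zero; the letter `hθ1`, discharged for `θ(g) = χ₁(g₀₀)` by `χ₁(1) = 1`):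
  **`toFun_weyl_mul_eq_of_one_lt_v`** (`|z|_w > 1`: `f(w₀u) = χ₁((σb)⁻¹)·χ₂(−1)·‖b‖⁻¹·f(1)`, `b = u₀₂`; ★ FILE 2 §2 + §5 + §1 here) and **`toFun_conj_weyl_eq_of_one_le_v`** (`|z|_w ≥ 1`:
  `f(w₀uw₀) = χ₁((σb)⁻¹)·χ₂(−1)·‖b‖⁻¹·f(w₀)`; ★ FILE 2 §3 + §5 + §1 here).
* §3 the complementary regions for the NORMALISED basis of ★ p861529 `K2E3IwahoriTypeBasisMackey` (letters `h1g : f₁(w₀) = 0`, `hw1 : f_w(1) = 0`): **`toFun_weyl_mul_eq_zero_of_v_le_one`**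
  (`|z|_w ≤ 1 ⇒ f₁(w₀u) = θ(u)f₁(w₀) = 0`) and **`toFun_conj_weyl_eq_zero_of_v_lt_one`** (`|z|_w < 1 ⇒ f_w(w₀uw₀) = θ(w₀uw₀)f_w(1) = 0`) — no `θ`-letter needed.
So `G₁ = Λ_1 f₁ = ∫_{|z|_w > 1} χ₁((σz)⁻¹)χ₂(−1)‖z‖⁻¹ dμ_N` and `G₂ = Λ_{w₀} f_w = ∫_{|z|_w ≥ 1} χ₁((σz)⁻¹)χ₂(−1)‖z‖⁻¹ dμ_N` — the two shell sums of `PAPER-Z3` §1 (sequel: the shell files of Z3-c).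

HONEST LABEL: HC_CM is proved only modulo the 7 printed citations (2 remaining named inputs: hLiu418 = stmt-HodgeConjecture-24832, h413 = stmt-HodgeConjecture-24833)
until rung 0 closes; count-neutral — this file does NOT pay the socket; no printed citation is discharged.

## References
* [Casselman1980] W. Casselman, *The unramified principal series of p-adic groups I*, Compositio Math. 40 (1980), §3 (intertwining operators on the Iwahori-fixed vectors).
* [Casselman1995] W. Casselman, *Introduction to the theory of admissible representations of `p`-adic reductive groups* (1995), Prop. 1.3.3, §6.4 (rank-one intertwining integrals).
* [Keys1984] D. Keys, *Principal series representations of special unitary groups over local fields*, Compositio Math. 51 (1984), §3, §7 Theorem (2) p. 126.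
* [Rogawski1990] J. Rogawski, *Automorphic representations of unitary groups in three variables*, Ann. of Math. Stud. 123 (1990), §1.10 p. 9, §12.1 p. 171.
-/

set_option autoImplicit false
-- the mandated namespace has the single-problem summit's repeated segment (`HodgeConjecture.HodgeConjecture`)
set_option linter.dupNamespace false

noncomputable section

open NumberField IsDedekindDomain
open scoped Matrix MatrixGroups WithZero Valued NNReal
open Literature.NumberTheory Literature.NumberTheory.Automorphic Literature.NumberTheory.Automorphic.UnitaryGroup
open Literature.NumberTheory.Rogawski1990

namespace Summit.HodgeConjecture.HodgeConjecture.Cruxes.H413.K2E3BranchBCasselmanPairIntegrands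

open Summit.HodgeConjecture.HodgeConjecture.Cruxes.H413 Summit.HodgeConjecture.HodgeConjecture.Cruxes.H413.K2E3DepthZeroIwahoriCharacterCM
open Summit.HodgeConjecture.HodgeConjecture.Cruxes.H413.K2E3BranchATorusWitnessCM
open Summit.HodgeConjecture.HodgeConjecture.Cruxes.H413.K2E3BranchBCellFunctionsCM

variable (L : Type) [Field L] [NumberField L] [IsCMField L] (v : HeightOneSpectrum (𝓞 ↥(maximalRealSubfield L)))
  (w : PlacesOver L v) (hw : IsCMField.complexConj L • w.1 = w.1)
  (eA : Gqs L v ≃ₜ* ↥(unitaryGroupOfForm (galAdicCompletionMap (L := L) (IsCMField.complexConj L) hw) ((StdForm.antidiagonal 3).over (w.1.adicCompletion L))))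
  (heA : ∀ g : Gqs L v,
    ((eA g : ↥(unitaryGroupOfForm (galAdicCompletionMap (L := L) (IsCMField.complexConj L) hw) ((StdForm.antidiagonal 3).over (w.1.adicCompletion L)))) :
        GL (Fin 3) (w.1.adicCompletion L)) =
      ((localNonsplitEquiv (IsCMField.complexConj L) (qsForm L) (IsCMField.complexConj_ne_one L) w hw g :
        ↥(unitaryGroupOfForm (galAdicCompletionMap (L := L) (IsCMField.complexConj L) hw) (placeForm (qsForm L) w.1))) : GL (Fin 3) (w.1.adicCompletion L)))
  {ϖ : w.1.adicCompletion L} (hϖ : Valued.v ϖ = WithZero.exp (-1 : ℤ))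
  (g₁ : GL (Fin 3) (w.1.adicCompletion L)) (hg₁ : (g₁ : Matrix (Fin 3) (Fin 3) (w.1.adicCompletion L)) = Matrix.diagonal ![(1 : w.1.adicCompletion L), 1, ϖ])
  (K0 K1 I : Subgroup (Gqs L v))
  (hK0 : K0 = ((glInt 3 (w.1.adicCompletion L)).subgroupOf
    (unitaryGroupOfForm (galAdicCompletionMap (L := L) (IsCMField.complexConj L) hw) ((StdForm.antidiagonal 3).over (w.1.adicCompletion L)))).comap
      eA.toMulEquiv.toMonoidHom)
  (hK1 : K1 = (((glInt 3 (w.1.adicCompletion L)).map (MulAut.conj g₁).toMonoidHom).subgroupOf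
    (unitaryGroupOfForm (galAdicCompletionMap (L := L) (IsCMField.complexConj L) hw) ((StdForm.antidiagonal 3).over (w.1.adicCompletion L)))).comap
      eA.toMulEquiv.toMonoidHom)
  (hI : I = K0 ⊓ K1)
  (w₀ : Gqs L v) (hw₀ : Units.val (w₀.val : GL (Fin 3) (LocalRing L v)) = cmLocalForm L 3 v)
  (χ₁ : (LocalRing L v)ˣ →* ℂˣ) (χ₂ : ↥(normOneUnits (conjLocal L (IsCMField.complexConj L) v)) →* ℂˣ)

/-! ## §1 The `τ(p)`-reading of the Borel factor -/

include hw heA in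
set_option maxHeartbeats 1600000 in
set_option synthInstance.maxHeartbeats 400000 in
-- two definitionally equal carriers of `U(Φ₃)(L⁺_v)` (`Gqs L v` and the matrix subgroup); unification is slow (class of ★ Z2A-3c (ii), ★ Z2-B CM)
/-- **THE `τ(p)`-READING.**  For `p ∈ P` whose place matrix is `eA p = [[(σz)⁻¹, −x∕z, 1],[0, −σz∕z, −σx],[0, 0, z]]` (the Borel factor of ★ Z3-a FILE 2 §2∕§3) and a unit `b` of
`L ⊗ L⁺_v` with `b_w = z`: `(((χ₁, χ₂) ∘ proj) ⊗ δ_B^{1∕2})(p) · 1 = χ₁((σb)⁻¹) · χ₂(−1) · ‖b‖⁻¹` — `δ_B^{1∕2}(p) = ‖(proj p)₀₀‖ = ‖(σb)⁻¹‖ = ‖b‖⁻¹`, `(proj p)₀₀ = (σb)⁻¹`,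
`det (proj p) = (σz)⁻¹ · (−σz∕z) · z = −1`. [cite: Rogawski1990, §12.1 p. 171] [cite: Casselman1995, Prop. 1.3.3] [cite: Keys1984, §7] -/
theorem tau_apply_one_eq {p : Gqs L v} (hp : (p : ↥(unitaryGroupOfForm (conjLocal L (IsCMField.complexConj L) v) (cmLocalForm L 3 v))) ∈ (cmBorelTriple L 3 v).P)
    {x z : w.1.adicCompletion L}
    (hpm : (((eA p : ↥(unitaryGroupOfForm (galAdicCompletionMap (L := L) (IsCMField.complexConj L) hw) ((StdForm.antidiagonal 3).over (w.1.adicCompletion L)))) :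
          GL (Fin 3) (w.1.adicCompletion L)) : Matrix (Fin 3) (Fin 3) (w.1.adicCompletion L)) =
        !![(galAdicCompletionMap (L := L) (IsCMField.complexConj L) hw z)⁻¹, -(x * z⁻¹), 1;
           0, -(galAdicCompletionMap (L := L) (IsCMField.complexConj L) hw z * z⁻¹), -galAdicCompletionMap (L := L) (IsCMField.complexConj L) hw x;
           0, 0, z])
    (b : (LocalRing L v)ˣ) (hbz : (b : LocalRing L v) w = z) :
    (haveI := locallyCompactSpace_cmBorelU L 3 v
     (Representation.twist
        (((Representation.trivial ℂ ↥(torusU (conjLocal L (IsCMField.complexConj L) v) (cmLocalForm L 3 v)) ℂ).twist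
          (cmTorusCharPair L v χ₁ χ₂)).comp (cmBorelTriple L 3 v).proj) (rootDeltaChar (cmBorelTriple L 3 v).P)) ⟨_, hp⟩ 1) =
      (((χ₁ (Units.map (conjLocal L (IsCMField.complexConj L) v : LocalRing L v →* LocalRing L v) b))⁻¹ : ℂˣ) : ℂ) *
        ((χ₂ ⟨-1, F0P3cStCharTSBigCellFactorisation.neg_one_mem_normOneUnits (conjLocal L (IsCMField.complexConj L) v)⟩ : ℂˣ) : ℂ) *
        ((((unitModulusChar (LocalRing L v) b)⁻¹ : ℝ≥0) : ℝ) : ℂ) := by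
  haveI := locallyCompactSpace_cmBorelU L 3 v
  haveI : Algebra.IsQuadraticExtension ↥(maximalRealSubfield L) L := IsCMField.isQuadraticExtension L
  have hJ : cmLocalForm L 3 v = (StdForm.antidiagonal 3).over (LocalRing L v) := cmLocalForm_eq_over L 3 v
  have hσ := conjLocal_conjLocal_cm L v
  -- `z ≠ 0` (it is the `w`-component of a unit)
  have hz0 : z ≠ 0 := by
    rw [← hbz]
    intro h
    have h1 : ((b : LocalRing L v) * ((b⁻¹ : (LocalRing L v)ˣ) : LocalRing L v)) w = 1 := by rw [Units.mul_inv]; rfl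
    rw [Pi.mul_apply, h, zero_mul] at h1
    exact zero_ne_one h1
  have hσz0 : galAdicCompletionMap (L := L) (IsCMField.complexConj L) hw z ≠ 0 := fun h => hz0 (by
    have := congrArg (galAdicCompletionMap (L := L) (IsCMField.complexConj L) hw) h
    rwa [galAdicCompletionMap_galAdicCompletionMap_of_smul_eq (IsCMField.complexConj L) w (IsCMField.complexConj_ne_one L) hw, map_zero] at this)
  -- the entries of `p` at `w`
  have h00 : ((p.val : GL (Fin 3) (LocalRing L v)) : Matrix (Fin 3) (Fin 3) (LocalRing L v)) 0 0 w = (galAdicCompletionMap (L := L) (IsCMField.complexConj L) hw z)⁻¹ := by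
    rw [← coe_eA_apply L v w hw eA heA p 0 0, hpm]; rfl
  have h11 : ((p.val : GL (Fin 3) (LocalRing L v)) : Matrix (Fin 3) (Fin 3) (LocalRing L v)) 1 1 w =
      -(galAdicCompletionMap (L := L) (IsCMField.complexConj L) hw z * z⁻¹) := by
    rw [← coe_eA_apply L v w hw eA heA p 1 1, hpm]; rfl
  have h22 : ((p.val : GL (Fin 3) (LocalRing L v)) : Matrix (Fin 3) (Fin 3) (LocalRing L v)) 2 2 w = z := by
    rw [← coe_eA_apply L v w hw eA heA p 2 2, hpm]; rfl
  set pP : ↥(cmBorelTriple L 3 v).P := ⟨_, hp⟩ with hpP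
  -- (i) `torusEntry₀ (proj p) = (σ b)⁻¹`
  have hentry : torusEntry (conjLocal L (IsCMField.complexConj L) v) (cmLocalForm L 3 v) 0 ((cmBorelTriple L 3 v).proj pP) =
      (Units.map (conjLocal L (IsCMField.complexConj L) v : LocalRing L v →* LocalRing L v) b)⁻¹ := by
    rw [eq_inv_iff_mul_eq_one]
    apply Units.ext
    rw [Units.val_mul, Units.coe_map, MonoidHom.coe_coe, Units.val_one, coe_torusEntry_proj_borelTriple,
      LocalRing.eq_iff_apply_eq (IsCMField.complexConj L) (IsCMField.complexConj_ne_one L) w hw, Pi.mul_apply, Pi.one_apply,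
      conjLocal_apply_eq_of_smul_eq (IsCMField.complexConj L) (IsCMField.complexConj_ne_one L) v w hw, hbz]
    change ((p.val : GL (Fin 3) (LocalRing L v)) : Matrix (Fin 3) (Fin 3) (LocalRing L v)) 0 0 w * _ = 1
    rw [h00, inv_mul_cancel₀ hσz0]
  -- (ii) `det (proj p) = −1`
  have hdet : torusDetNormOne (conjLocal L (IsCMField.complexConj L) v) (cmLocalForm L 3 v) hJ ((cmBorelTriple L 3 v).proj pP) =
      ⟨-1, F0P3cStCharTSBigCellFactorisation.neg_one_mem_normOneUnits (conjLocal L (IsCMField.complexConj L) v)⟩ := by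
    refine Subtype.ext (Units.ext ?_)
    rw [coe_torusDetNormOne, coe_torusDet, val_proj_borelTriple, Matrix.det_diagonal, Fin.prod_univ_three, Units.val_neg, Units.val_one,
      LocalRing.eq_iff_apply_eq (IsCMField.complexConj L) (IsCMField.complexConj_ne_one L) w hw, Pi.mul_apply, Pi.mul_apply, Pi.neg_apply, Pi.one_apply]
    change ((p.val : GL (Fin 3) (LocalRing L v)) : Matrix (Fin 3) (Fin 3) (LocalRing L v)) 0 0 w *
        ((p.val : GL (Fin 3) (LocalRing L v)) : Matrix (Fin 3) (Fin 3) (LocalRing L v)) 1 1 w *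
        ((p.val : GL (Fin 3) (LocalRing L v)) : Matrix (Fin 3) (Fin 3) (LocalRing L v)) 2 2 w = -1
    rw [h00, h11, h22]
    field_simp
  -- (iii) `δ_B^{1/2}(p) = ‖(σb)⁻¹‖ = ‖b‖⁻¹`
  have hδ : ((rootDeltaChar (cmBorelTriple L 3 v).P pP : ℂˣ) : ℂ) = ((((unitModulusChar (LocalRing L v) b)⁻¹ : ℝ≥0) : ℝ) : ℂ) := by
    rw [F0P2oBorelTorusModulus.rootDeltaChar_cmBorel_eq_unitModulusChar_proj L v pP, hentry, map_inv]
    borelize (LocalRing L v)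
    congr 3
    exact HeisRing.distribHaarChar_map_eq (conjLocal L (IsCMField.complexConj L) v) hσ (continuous_conjLocal L (IsCMField.complexConj L) v) b
  -- evaluate
  rw [twist_comp_proj_apply_one (cmBorelTriple L 3 v) (cmTorusCharPair L v χ₁ χ₂) (rootDeltaChar (cmBorelTriple L 3 v).P) pP, hδ,
    show cmTorusCharPair L v χ₁ χ₂ = torusCharPair (conjLocal L (IsCMField.complexConj L) v) (cmLocalForm L 3 v) hJ 0 χ₁ χ₂ from rfl,
    torusCharPair_apply, hentry, hdet, map_inv, Units.val_mul]
  ring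

/-! ## §2 The two non-constant cell values of an `(I, θ)`-eigen-section -/

section EigenSection

variable (θ : Gqs L v → ℂ)
  (hθ1 : ∀ g ∈ I, ((g.val : GL (Fin 3) (LocalRing L v)) : Matrix (Fin 3) (Fin 3) (LocalRing L v)) 0 0 = 1 → θ g = 1)

include hw heA hϖ hg₁ hK0 hK1 hI hw₀ hθ1 in
set_option maxHeartbeats 1600000 in
set_option synthInstance.maxHeartbeats 400000 in
-- two carriers, slow unification (as above)
/-- **`|z|_w > 1`: `f(w₀ u) = χ₁((σb)⁻¹) · χ₂(−1) · ‖b‖⁻¹ · f(1)`**, `b = u₀₂` (`b_w = z`), for an `(I, θ)`-eigen-section `f` of `i_G(χ₁, χ₂)` with `θ = 1` on the elements of `I` of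
`(0,0)`-entry `1`: `w₀ u = p κ` (★ Z3-a FILE 2 §2), `f(pκ) = τ(p) θ(κ) f(1)` (★ FILE 2 §5), `θ(κ) = 1` (`κ₀₀ = 1`), `τ(p)` by §1.  The integrand of `G₁ = Λ_1 f₁` on `N ∖ N₀` (`PAPER-Z3` §1).
[cite: Casselman1980, §3] [cite: Casselman1995, §6.4] [cite: Keys1984, §7 Theorem (2) p. 126] -/
theorem toFun_weyl_mul_eq_of_one_lt_v
    (f : haveI := locallyCompactSpace_cmBorelU L 3 v
      Representation.SmoothInd (cmBorelTriple L 3 v).P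
        (Representation.twist
          (((Representation.trivial ℂ ↥(torusU (conjLocal L (IsCMField.complexConj L) v) (cmLocalForm L 3 v)) ℂ).twist
            (cmTorusCharPair L v χ₁ χ₂)).comp (cmBorelTriple L 3 v).proj) (rootDeltaChar (cmBorelTriple L 3 v).P)))
    (heig : haveI := locallyCompactSpace_cmBorelU L 3 v
      ∀ j ∈ I, Representation.smoothIndRep (cmBorelTriple L 3 v).P _ j f = θ j • f)
    {u : Gqs L v}
    (hu : (u : ↥(unitaryGroupOfForm (conjLocal L (IsCMField.complexConj L) v) (cmLocalForm L 3 v))) ∈ (cmBorelTriple L 3 v).N)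
    (hb : IsUnit (((u.val : GL (Fin 3) (LocalRing L v)) : Matrix (Fin 3) (Fin 3) (LocalRing L v)) 0 2))
    (hz : 1 < Valued.v ((((u.val : GL (Fin 3) (LocalRing L v)) : Matrix (Fin 3) (Fin 3) (LocalRing L v)) 0 2) w)) :
    f.toFun (w₀ * u) =
      ((((χ₁ (Units.map (conjLocal L (IsCMField.complexConj L) v : LocalRing L v →* LocalRing L v) hb.unit))⁻¹ : ℂˣ) : ℂ) *
        ((χ₂ ⟨-1, F0P3cStCharTSBigCellFactorisation.neg_one_mem_normOneUnits (conjLocal L (IsCMField.complexConj L) v)⟩ : ℂˣ) : ℂ) *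
        ((((unitModulusChar (LocalRing L v) hb.unit)⁻¹ : ℝ≥0) : ℝ) : ℂ)) * f.toFun 1 := by
  haveI := locallyCompactSpace_cmBorelU L 3 v
  obtain ⟨x, z, hux, hrel⟩ := exists_coe_eA_eq_upper L v w hw eA heA (cmBorelTriple L 3 v) rfl hu
  have hz02 : (((u.val : GL (Fin 3) (LocalRing L v)) : Matrix (Fin 3) (Fin 3) (LocalRing L v)) 0 2) w = z := by
    rw [← coe_eA_apply L v w hw eA heA u 0 2, hux]; rfl
  have hz' : 1 < Valued.v z := by rwa [hz02] at hz
  obtain ⟨p, hp, κ, hκ, hfac, hpm, hκm⟩ :=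
    exists_eq_mul_of_one_lt_v L v w hw eA heA hϖ g₁ hg₁ K0 K1 I hK0 hK1 hI (cmBorelTriple L 3 v) rfl w₀ hw₀ hux hrel hz'
  have hκ00 : ((κ.val : GL (Fin 3) (LocalRing L v)) : Matrix (Fin 3) (Fin 3) (LocalRing L v)) 0 0 = 1 := by
    rw [LocalRing.eq_iff_apply_eq (IsCMField.complexConj L) (IsCMField.complexConj_ne_one L) w hw, ← coe_eA_apply L v w hw eA heA κ 0 0, hκm]; rfl
  have hcell := toFun_weyl_mul_of_eq_mul L v I (cmBorelTriple L 3 v) w₀ _ θ f heig hp hκ hfac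
  have hτ := tau_apply_one_eq L v w hw eA heA χ₁ χ₂ hp hpm hb.unit (by rw [hb.unit_spec]; exact hz02)
  rw [hθ1 κ hκ hκ00, mul_one] at hcell
  exact hcell.trans (congrArg (· * f.toFun 1) hτ)

include hw heA hϖ hg₁ hK0 hK1 hI hw₀ hθ1 in
set_option maxHeartbeats 1600000 in
set_option synthInstance.maxHeartbeats 400000 in
-- two carriers, slow unification (as above)
/-- **`|z|_w ≥ 1`: `f(w₀ u w₀) = χ₁((σb)⁻¹) · χ₂(−1) · ‖b‖⁻¹ · f(w₀)`**, `b = u₀₂`: `w₀ u w₀ = p w₀ n₂` (★ Z3-a FILE 2 §3), `f(p w₀ n₂) = τ(p) θ(n₂) f(w₀)` (★ FILE 2 §5), `θ(n₂) = 1`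
(`(n₂)₀₀ = 1`), `τ(p)` by §1.  The integrand of `G₂ = Λ_{w₀} f_w` on `{|z|_w ≥ 1}` (`PAPER-Z3` §1). [cite: Casselman1980, §3] [cite: Casselman1995, §6.4] [cite: Keys1984, §7 Theorem (2) p. 126] -/
theorem toFun_conj_weyl_eq_of_one_le_v
    (f : haveI := locallyCompactSpace_cmBorelU L 3 v
      Representation.SmoothInd (cmBorelTriple L 3 v).P
        (Representation.twist
          (((Representation.trivial ℂ ↥(torusU (conjLocal L (IsCMField.complexConj L) v) (cmLocalForm L 3 v)) ℂ).twist
            (cmTorusCharPair L v χ₁ χ₂)).comp (cmBorelTriple L 3 v).proj) (rootDeltaChar (cmBorelTriple L 3 v).P)))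
    (heig : haveI := locallyCompactSpace_cmBorelU L 3 v
      ∀ j ∈ I, Representation.smoothIndRep (cmBorelTriple L 3 v).P _ j f = θ j • f)
    {u : Gqs L v}
    (hu : (u : ↥(unitaryGroupOfForm (conjLocal L (IsCMField.complexConj L) v) (cmLocalForm L 3 v))) ∈ (cmBorelTriple L 3 v).N)
    (hb : IsUnit (((u.val : GL (Fin 3) (LocalRing L v)) : Matrix (Fin 3) (Fin 3) (LocalRing L v)) 0 2))
    (hz : 1 ≤ Valued.v ((((u.val : GL (Fin 3) (LocalRing L v)) : Matrix (Fin 3) (Fin 3) (LocalRing L v)) 0 2) w)) :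
    f.toFun (w₀ * u * w₀) =
      ((((χ₁ (Units.map (conjLocal L (IsCMField.complexConj L) v : LocalRing L v →* LocalRing L v) hb.unit))⁻¹ : ℂˣ) : ℂ) *
        ((χ₂ ⟨-1, F0P3cStCharTSBigCellFactorisation.neg_one_mem_normOneUnits (conjLocal L (IsCMField.complexConj L) v)⟩ : ℂˣ) : ℂ) *
        ((((unitModulusChar (LocalRing L v) hb.unit)⁻¹ : ℝ≥0) : ℝ) : ℂ)) * f.toFun w₀ := by
  haveI := locallyCompactSpace_cmBorelU L 3 v
  obtain ⟨x, z, hux, hrel⟩ := exists_coe_eA_eq_upper L v w hw eA heA (cmBorelTriple L 3 v) rfl hu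
  have hz02 : (((u.val : GL (Fin 3) (LocalRing L v)) : Matrix (Fin 3) (Fin 3) (LocalRing L v)) 0 2) w = z := by
    rw [← coe_eA_apply L v w hw eA heA u 0 2, hux]; rfl
  have hz' : 1 ≤ Valued.v z := by rwa [hz02] at hz
  obtain ⟨p, hp, n₂, hn₂, hfac, hpm, hn₂m⟩ :=
    exists_conj_eq_mul_of_one_le_v L v w hw eA heA hϖ g₁ hg₁ K0 K1 I hK0 hK1 hI (cmBorelTriple L 3 v) rfl w₀ hw₀ hux hrel hz'
  have hn00 : ((n₂.val : GL (Fin 3) (LocalRing L v)) : Matrix (Fin 3) (Fin 3) (LocalRing L v)) 0 0 = 1 := by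
    rw [LocalRing.eq_iff_apply_eq (IsCMField.complexConj L) (IsCMField.complexConj_ne_one L) w hw, ← coe_eA_apply L v w hw eA heA n₂ 0 0, hn₂m]; rfl
  have hcell := toFun_conj_of_eq_mul L v I (cmBorelTriple L 3 v) w₀ _ θ f heig hp hn₂ hfac
  have hτ := tau_apply_one_eq L v w hw eA heA χ₁ χ₂ hp hpm hb.unit (by rw [hb.unit_spec]; exact hz02)
  rw [hθ1 n₂ hn₂ hn00, mul_one] at hcell
  exact hcell.trans (congrArg (· * f.toFun w₀) hτ)

/-! ## §3 The complementary regions for the normalised basis -/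

include hw heA hϖ hg₁ hK0 hK1 hI in
set_option maxHeartbeats 1600000 in
set_option synthInstance.maxHeartbeats 400000 in
-- two carriers, slow unification (as above)
/-- **`|z|_w ≤ 1 ⇒ f(w₀ u) = 0` when `f(w₀) = 0`** (`u ∈ N₀ = N ∩ I` by ★ Z3-a FILE 2 §1, `f(w₀u) = θ(u) f(w₀)` by ★ FILE 2 §5): the normalised `f₁` (`h1g`) of ★ `K2E3IwahoriTypeBasisMackey`
vanishes there, so `G₁ = Λ_1 f₁` is an integral over `{|z|_w > 1}` only. [cite: Casselman1980, §3] [cite: Keys1984, §7] -/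
theorem toFun_weyl_mul_eq_zero_of_v_le_one
    (f : haveI := locallyCompactSpace_cmBorelU L 3 v
      Representation.SmoothInd (cmBorelTriple L 3 v).P
        (Representation.twist
          (((Representation.trivial ℂ ↥(torusU (conjLocal L (IsCMField.complexConj L) v) (cmLocalForm L 3 v)) ℂ).twist
            (cmTorusCharPair L v χ₁ χ₂)).comp (cmBorelTriple L 3 v).proj) (rootDeltaChar (cmBorelTriple L 3 v).P)))
    (heig : haveI := locallyCompactSpace_cmBorelU L 3 v
      ∀ j ∈ I, Representation.smoothIndRep (cmBorelTriple L 3 v).P _ j f = θ j • f)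
    (h1g : f.toFun w₀ = 0) {u : Gqs L v}
    (hu : (u : ↥(unitaryGroupOfForm (conjLocal L (IsCMField.complexConj L) v) (cmLocalForm L 3 v))) ∈ (cmBorelTriple L 3 v).N)
    (hz : Valued.v ((((u.val : GL (Fin 3) (LocalRing L v)) : Matrix (Fin 3) (Fin 3) (LocalRing L v)) 0 2) w) ≤ 1) :
    f.toFun (w₀ * u) = 0 := by
  haveI := locallyCompactSpace_cmBorelU L 3 v
  obtain ⟨x, z, hux, hrel⟩ := exists_coe_eA_eq_upper L v w hw eA heA (cmBorelTriple L 3 v) rfl hu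
  have hz02 : (((u.val : GL (Fin 3) (LocalRing L v)) : Matrix (Fin 3) (Fin 3) (LocalRing L v)) 0 2) w = z := by
    rw [← coe_eA_apply L v w hw eA heA u 0 2, hux]; rfl
  have hz' : Valued.v z ≤ 1 := by rwa [hz02] at hz
  have huI : u ∈ I := (mem_iff_v_le_one L v w hw eA hϖ g₁ hg₁ K0 K1 I hK0 hK1 hI hux hrel).2 hz'
  have hcell := toFun_weyl_mul_of_mem L v I (cmBorelTriple L 3 v) w₀ _ θ f heig huI
  exact hcell.trans (mul_eq_zero_of_right _ h1g)

include hw heA hϖ hg₁ hK0 hK1 hI hw₀ in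
set_option maxHeartbeats 1600000 in
set_option synthInstance.maxHeartbeats 400000 in
-- two carriers, slow unification (as above)
/-- **`|z|_w < 1 ⇒ f(w₀ u w₀) = 0` when `f(1) = 0`** (`w₀uw₀ ∈ I` by ★ Z3-a FILE 2 §4, `f(w₀uw₀) = θ(w₀uw₀) f(1)` by ★ FILE 2 §5): the normalised `f_w` (`hw1`) of ★
`K2E3IwahoriTypeBasisMackey` vanishes there, so `G₂ = Λ_{w₀} f_w` is an integral over `{|z|_w ≥ 1}` only. [cite: Casselman1980, §3] [cite: Keys1984, §7] -/
theorem toFun_conj_weyl_eq_zero_of_v_lt_one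
    (f : haveI := locallyCompactSpace_cmBorelU L 3 v
      Representation.SmoothInd (cmBorelTriple L 3 v).P
        (Representation.twist
          (((Representation.trivial ℂ ↥(torusU (conjLocal L (IsCMField.complexConj L) v) (cmLocalForm L 3 v)) ℂ).twist
            (cmTorusCharPair L v χ₁ χ₂)).comp (cmBorelTriple L 3 v).proj) (rootDeltaChar (cmBorelTriple L 3 v).P)))
    (heig : haveI := locallyCompactSpace_cmBorelU L 3 v
      ∀ j ∈ I, Representation.smoothIndRep (cmBorelTriple L 3 v).P _ j f = θ j • f)
    (hw1 : f.toFun 1 = 0) {u : Gqs L v}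
    (hu : (u : ↥(unitaryGroupOfForm (conjLocal L (IsCMField.complexConj L) v) (cmLocalForm L 3 v))) ∈ (cmBorelTriple L 3 v).N)
    (hz : Valued.v ((((u.val : GL (Fin 3) (LocalRing L v)) : Matrix (Fin 3) (Fin 3) (LocalRing L v)) 0 2) w) < 1) :
    f.toFun (w₀ * u * w₀) = 0 := by
  haveI := locallyCompactSpace_cmBorelU L 3 v
  obtain ⟨x, z, hux, hrel⟩ := exists_coe_eA_eq_upper L v w hw eA heA (cmBorelTriple L 3 v) rfl hu
  have hz02 : (((u.val : GL (Fin 3) (LocalRing L v)) : Matrix (Fin 3) (Fin 3) (LocalRing L v)) 0 2) w = z := by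
    rw [← coe_eA_apply L v w hw eA heA u 0 2, hux]; rfl
  have hz' : Valued.v z < 1 := by rwa [hz02] at hz
  have huI : w₀ * u * w₀ ∈ I := (conj_mem_iff_v_lt_one L v w hw eA heA hϖ g₁ hg₁ K0 K1 I hK0 hK1 hI w₀ hw₀ hux hrel).2 hz'
  have hcell := toFun_conj_of_mem L v I (cmBorelTriple L 3 v) w₀ _ θ f heig huI
  exact hcell.trans (mul_eq_zero_of_right _ hw1)

end EigenSection

end Summit.HodgeConjecture.HodgeConjecture.Cruxes.H413.K2E3BranchBCasselmanPairIntegrands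

end
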